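import Literature.NumberTheory.GaloisRepresentations.ContinuousCohomologyCorankModPrime
import HarnessLib

/-!
# Greenberg's Krull-dimension reduction for Euler–Poincaré characteristics of coranks

Topic `NumberTheory/GaloisRepresentations`; namespace `Literature.NumberTheory.GaloisRepresentations`;
THEOREMS ONLY (no definition, no named fact, no `sorry`).

The inductive step of R. Greenberg's proof of the Euler–Poincaré corank formulas (*On the
structure of certain Galois cohomology groups* (2006), Props. 4.1/4.2, proof p. 368 L25–52), as
one theorem about Mathlib's continuous cohomology of a compact group `Γ` with discrete
coefficients: if the formula `Σ_{i≤2} (−1)ⁱ rank Hⁱ(Γ, ·)^∨ = −c · rank (·)^∨` holds for all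
cofinitely generated discrete `p`-primary representations over `R' = R/(T)` (`T ≠ 0` a prime
element of the Noetherian domain `R`), and over `R` cohomology is cofinitely generated with
`H³ = 0` on such modules, then the formula holds over `R`
(`alternatingSum_finrank_characterModule_H_of_quotient`).  Assembled from
`ContinuousCohomologyCorankModPrime.lean` (the three book-keeping identities) and
`Literature.Algebra.Module.exists_pow_smul_divisible` (`T^k D` is `T`-divisible).

## References
* R. Greenberg, *On the structure of certain Galois cohomology groups*, Doc. Math. Extra Vol.
  Coates (2006) 335–391, §4 A (proof of Props. 4.1/4.2, p. 368 L25–52). [Greenberg2006]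
-/

noncomputable section

open CategoryTheory Limits

namespace Literature.NumberTheory.GaloisRepresentations

open _root_.TopRep _root_.ContRepresentation _root_.ContinuousCohomology
open _root_.Module Submodule Literature.Algebra.Module

/-! ## §5. The reduction step `R ↦ R/(T)` for Euler characteristics of coranks -/

section Engine

variable {R : Type} [CommRing R] [TopologicalSpace R] [IsTopologicalRing R] [IsNoetherianRing R]
  [IsDomain R]
variable {Γ : Type} [Group Γ] [TopologicalSpace Γ] [IsTopologicalGroup Γ] [CompactSpace Γ]
variable {D : Type} [AddCommGroup D] [Module R D] [TopologicalSpace D] [DiscreteTopology D]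
  [ContinuousSMul R D]

/-- **Greenberg's Krull-dimension reduction for the Euler–Poincaré characteristic of coranks**
(proof of Props. 4.1/4.2 of *On the structure of certain Galois cohomology groups*, p. 368: "The
Euler–Poincaré characteristic is additive … `D/D_{Λ-div}` is `Λ`-cotorsion … we can assume … that
`D` is `Λ`-divisible … If the Krull dimension of `Λ` is `1` … One determines the `ℤ_p`-corank by
reducing to the case of the finite modules `D[pⁿ]` … `(Λ/P)` is also a formal power series ring,
but with Krull dimension reduced by `1` … reduces the proof … to the corresponding result for
`D[P]` considered as a module over … `(Λ/P)`. By induction, we are done.").  Let `Γ` be compact,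
`R` a Noetherian domain, `T ≠ 0` a prime element with `R' = R/(T)`, `p` a number and `c` an
integer.  Assume, for discrete `p`-primary modules with finitely generated duals: (i) over `R`,
the continuous cohomology of `Γ` has finitely generated duals and `H³ = 0`; (ii) over `R'`, the
Euler–Poincaré formula `Σ_{i≤2} (−1)ⁱ rank_{R'} Hⁱ(Γ, B)^∨ = −c · rank_{R'} B^∨` holds for every
continuous `R'`-representation `B`.  Then the formula holds over `R`:
`Σ_{i≤2} (−1)ⁱ rank_R Hⁱ(Γ, D)^∨ = −c · rank_R D^∨`.
[cite: Greenberg2006, §4 A (proof of Props. 4.1/4.2, p. 368 L25–52)] -/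
theorem alternatingSum_finrank_characterModule_H_of_quotient {T : R} (hT0 : T ≠ 0)
    (hT : (Ideal.span {T}).IsPrime) (p : ℕ) (c : ℤ)
    (hcof : ∀ {M : Type} [AddCommGroup M] [Module R M] [TopologicalSpace M] [DiscreteTopology M]
      [ContinuousSMul R M] (σ : ContinuousRep Γ R M), (∀ m : M, ∃ n : ℕ, (p ^ n : ℤ) • m = 0) →
      Module.Finite R (CharacterModule M) → ∀ n : ℕ, Module.Finite R (CharacterModule (σ.H n)))
    (hcd : ∀ {M : Type} [AddCommGroup M] [Module R M] [TopologicalSpace M] [DiscreteTopology M]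
      [ContinuousSMul R M] (σ : ContinuousRep Γ R M), (∀ m : M, ∃ n : ℕ, (p ^ n : ℤ) • m = 0) →
      Subsingleton (σ.H 3))
    (hIH : ∀ {B : Type} [AddCommGroup B] [Module (R ⧸ Ideal.span {T}) B] [TopologicalSpace B]
      [DiscreteTopology B] [ContinuousSMul (R ⧸ Ideal.span {T}) B]
      (σ : ContinuousRep Γ (R ⧸ Ideal.span {T}) B), (∀ b : B, ∃ n : ℕ, (p ^ n : ℤ) • b = 0) →
      Module.Finite (R ⧸ Ideal.span {T}) (CharacterModule B) →
      (finrank (R ⧸ Ideal.span {T}) (CharacterModule (σ.H 0)) : ℤ) -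
          finrank (R ⧸ Ideal.span {T}) (CharacterModule (σ.H 1)) +
          finrank (R ⧸ Ideal.span {T}) (CharacterModule (σ.H 2)) =
        -(c * finrank (R ⧸ Ideal.span {T}) (CharacterModule B)))
    (τ : ContinuousRep Γ R D) (hp : ∀ d : D, ∃ n : ℕ, (p ^ n : ℤ) • d = 0)
    (hD : Module.Finite R (CharacterModule D)) :
    (finrank R (CharacterModule (τ.H 0)) : ℤ) - finrank R (CharacterModule (τ.H 1)) +
        finrank R (CharacterModule (τ.H 2)) = -(c * finrank R (CharacterModule D)) := by
  haveI := hD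
  haveI : IsDomain (R ⧸ Ideal.span {T}) := (Ideal.Quotient.isDomain_iff_prime _).mpr hT
  -- Step A: `D' = T^k D` is `T`-divisible, `T^k D ⊆ D'`
  obtain ⟨k, hk⟩ := exists_pow_smul_divisible (D := D) T
  let D' : Submodule R D := LinearMap.range (T ^ k • (LinearMap.id : D →ₗ[R] D))
  have hD'st : ∀ g : Γ, D' ≤ D'.comap (τ g) := by
    rintro g _ ⟨x, rfl⟩
    exact ⟨τ g x, by simp⟩
  have hquot : ∀ d : D, T ^ k • d ∈ D' := fun d => ⟨d, rfl⟩
  let σ := τ.subrepresentation D' hD'st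
  -- the `T`-torsion `A = D'[T]` and the short exact sequence `0 → A → D' →(T·) D' → 0`
  let A : Submodule R D' := torsionBy R D' T
  let σA := σ.subrepresentation A (σ.torsionBy_smul_le_comap T)
  let ι : σA.toTopRep ⟶ σ.toTopRep := TopRep.ofHom
    { toLinearMap := A.subtype
      cont := continuous_subtype_val
      isIntertwining' := fun _ => rfl }
  let μ : σ.toTopRep ⟶ σ.toTopRep := TopRep.ofHom
    { toLinearMap := T • LinearMap.id
      cont := continuous_of_discreteTopology
      isIntertwining' := fun g => by ext y; simp }
  have hμ : ∀ y : D', μ.hom y = T • y := fun _ => rfl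
  have hSES : IsSES ι μ :=
    { comp_eq_zero := by
        ext a
        exact congrArg Subtype.val ((mem_torsionBy_iff T (a : D')).1 a.2)
      injective := Subtype.val_injective
      exact_mid := fun y hy => ⟨⟨y, (mem_torsionBy_iff T y).2 hy⟩, rfl⟩
      surjective := fun y => by
        obtain ⟨z, hz, hzy⟩ := hk y y.2
        exact ⟨⟨z, hz⟩, Subtype.ext hzy⟩ }
  -- p-primarity and finite generation of the players
  have hpσ : ∀ y : D', ∃ n : ℕ, (p ^ n : ℤ) • y = 0 := fun y => by
    obtain ⟨n, hn⟩ := hp y; exact ⟨n, Subtype.ext hn⟩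
  have hpA : ∀ a : A, ∃ n : ℕ, (p ^ n : ℤ) • a = 0 := fun a => by
    obtain ⟨n, hn⟩ := hpσ a; exact ⟨n, Subtype.ext hn⟩
  haveI hD'fin : Module.Finite R (CharacterModule D') :=
    Module.Finite.of_surjective _ (CharacterModule.dual_surjective_of_injective _ D'.injective_subtype)
  haveI hAfin : Module.Finite R (CharacterModule A) :=
    Module.Finite.of_surjective _ (CharacterModule.dual_surjective_of_injective _ A.injective_subtype)
  haveI := fun n => hcof τ hp hD n
  haveI := fun n => hcof σ hpσ hD'fin n
  haveI := fun n => hcof σA hpA hAfin n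
  have hAT : ∀ a : A, T • a = 0 := fun a => (mem_torsionBy_iff T (a : D')).1 a.2 |> fun h =>
    Subtype.ext h
  -- Step B: the `R'`-representation on `A` and the induction hypothesis
  haveI : ContinuousSMul (R ⧸ Ideal.span {T}) A :=
    continuousSMul_quotient_of_discreteTopology (Ideal.span {T})
  obtain ⟨τA, hτA⟩ := exists_continuousRep_quotientRing (Ideal.span {T}) σA
  haveI : IsScalarTower R (R ⧸ Ideal.span {T}) (CharacterModule A) :=
    IsScalarTower.of_algebraMap_smul fun r χ => rfl
  haveI hAfin' : Module.Finite (R ⧸ Ideal.span {T}) (CharacterModule A) :=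
    Module.Finite.of_restrictScalars_finite R _ _
  have hIHA := hIH τA hpA hAfin'
  -- Step C: translate both sides of the induction hypothesis
  rw [finrank_characterModule_H_quotientRing_eq T σA τA hτA 0,
    finrank_characterModule_H_quotientRing_eq T σA τA hτA 1,
    finrank_characterModule_H_quotientRing_eq T σA τA hτA 2,
    finrank_characterModule_quotientRing_eq T (M := A),
    alternatingSum_finrank_torsionBy_characterModule_H_eq hT0 hT σA σ hSES hμ hAT (hcd σA hpA)
      (fun n => inferInstance) (fun n => inferInstance)] at hIHA
  -- `rank_{R'} A^∨[T] = rank_{R'} X'/TX' = rank_R X'` (`X' = D'^∨`, `X'[T] = 0`)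
  have hsurjT : Function.Surjective (T • (LinearMap.id : D' →ₗ[R] D')) := fun y => by
    obtain ⟨z, hz, hzy⟩ := hk y y.2
    exact ⟨⟨z, hz⟩, Subtype.ext hzy⟩
  have hexA : Function.Exact A.subtype (T • (LinearMap.id : D' →ₗ[R] D')) := fun y =>
    ⟨fun hy => ⟨⟨y, (mem_torsionBy_iff T y).2 hy⟩, rfl⟩, by
      rintro ⟨a, rfl⟩; exact (mem_torsionBy_iff T (a : D')).1 a.2⟩
  have hA1 : finrank (R ⧸ Ideal.span {T}) (torsionBy R (CharacterModule A) T) =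
      finrank (R ⧸ Ideal.span {T}) (CharacterModule D' ⧸ (Ideal.span {T} • ⊤ : Submodule R (CharacterModule D'))) :=
    finrank_torsionBy_eq_of_surjective T (CharacterModule.dual A.subtype)
      (fun χ => by ext a; rw [CharacterModule.smul_apply, hAT, map_zero]; rfl)
      (by simpa only [CharacterModule.dual_smul_id] using CharacterModule.exact_dual hexA)
      (CharacterModule.dual_surjective_of_injective _ A.injective_subtype)
  have hA2 : finrank (R ⧸ Ideal.span {T}) (torsionBy R (CharacterModule D') T) = 0 := by
    have hinj := CharacterModule.dual_injective_of_surjective _ hsurjT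
    rw [CharacterModule.dual_smul_id] at hinj
    haveI : Subsingleton (torsionBy R (CharacterModule D') T) := ⟨fun x y => Subtype.ext (hinj (by
      have hx := (mem_torsionBy_iff T (x : CharacterModule D')).mp x.2
      have hy := (mem_torsionBy_iff T (y : CharacterModule D')).mp y.2
      simp only [LinearMap.smul_apply, LinearMap.id_coe, id_eq, hx, hy]))⟩
    exact finrank_zero_of_subsingleton
  have hA3 := finrank_eq_finrank_quotient_sub_finrank_torsionBy hT0 hT (CharacterModule D')
  -- Step D: cotorsion corrections `D' ↦ D`
  have hTk : T ^ k ≠ 0 := pow_ne_zero k hT0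
  have c0 := finrank_characterModule_H_eq_of_smul_mem τ D' hD'st hTk hquot 0
  have c1 := finrank_characterModule_H_eq_of_smul_mem τ D' hD'st hTk hquot 1
  have c2 := finrank_characterModule_H_eq_of_smul_mem τ D' hD'st hTk hquot 2
  have cD := finrank_characterModule_eq_of_smul_mem D' hTk hquot
  have hq : (finrank (R ⧸ Ideal.span {T})
      (CharacterModule D' ⧸ (Ideal.span {T} • ⊤ : Submodule R (CharacterModule D'))) : ℤ) =
      finrank R (CharacterModule D') := by
    zify at hA2; linarith
  rw [c0, c1, c2, cD, hIHA, hA1, hq]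

end Engine

end Literature.NumberTheory.GaloisRepresentations

end
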